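import Summits.RiemannHypothesis.RiemannHypothesis.Theorems.PfPersistenceF6LadderCompress

/-!
# Pf-persistence, fake seat 6 (gen 3): forward gap rigidity is bounded by the SPAN ratio

mechanism/rigidity campaign; no RH claims.

cand-8's forward gap rigidity (`gapRigid ρ l l'`, rows cand8-010 / cand8-012, corridor `ρ ∈ (0.9567, 0.9710]`)
asks every one of the three consecutive log-gaps of the next window's foot ladder `l'` to keep the fraction `ρ`
of the corresponding gap of `l`.  Summing the three conjuncts gives the elementary necessary condition used in
fake-6's adversarial-maximum row (GAP-CLASSES, C8-N7(f)/(g)): the TOTAL log-span `l 3 - l 0 = lg (o₂/|e₁|)`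
must keep the fraction `ρ` as well.

* `gapRigid_span` — PROVED: `gapRigid ρ l l' → ρ * (l 3 - l 0) ≤ l' 3 - l' 0`.
* `not_gapRigid_of_span_lt` — PROVED: if the span of `l` is positive and `l' 3 - l' 0 < ρ * (l 3 - l 0)` then
  `¬ gapRigid ρ l l'` — a twin whose span collapses below the fraction `ρ` (DATA: every certified F6-TT2 member keeps
  `0.11–0.39` of its span one served step after going negative; the best 2-window adversary found keeps `0.57`)
  cannot pass the rigidity conjunct at `ρ = 0.9567`, whatever the individual gaps do.
* `minRatio_le_spanRatio` — PROVED (mediant form): for positive gaps `g i` and any `g' i` (`i < 3`), if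
  `θ * g i ≤ g' i` for all three `i` then `θ * (g 0 + g 1 + g 2) ≤ g' 0 + g' 1 + g' 2`; i.e. the rigidity index
  `θ = min g' i / g i` is at most the span ratio.

Elementary real inequalities; nothing is specific to ζ. [folklore]
-/

namespace Summit.RiemannHypothesis.RiemannHypothesis.Theorems.PfPersistence.F6

/-- PROVED: gap rigidity at fraction `ρ` forces the total log-span to keep the fraction `ρ`. [folklore] -/
theorem gapRigid_span {ρ : ℝ} {l l' : ℕ → ℝ} (h : gapRigid ρ l l') :
    ρ * (l 3 - l 0) ≤ l' 3 - l' 0 := by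
  have h0 := h 0 (by norm_num)
  have h1 := h 1 (by norm_num)
  have h2 := h 2 (by norm_num)
  simp only [Nat.reduceAdd] at h0 h1 h2
  nlinarith

/-- PROVED: a span that collapses below the fraction `ρ` refutes gap rigidity at `ρ`. [folklore] -/
theorem not_gapRigid_of_span_lt {ρ : ℝ} {l l' : ℕ → ℝ}
    (hlt : l' 3 - l' 0 < ρ * (l 3 - l 0)) : ¬ gapRigid ρ l l' :=
  fun h => absurd (gapRigid_span h) (not_le.mpr hlt)

/-- PROVED (mediant inequality): a common lower ratio bound on three gaps bounds the span ratio from below;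
equivalently the rigidity index `min g' i / g i` never exceeds `(Σ g') / (Σ g)`. [folklore] -/
theorem minRatio_le_spanRatio {θ : ℝ} {g g' : ℕ → ℝ}
    (h : ∀ i < 3, θ * g i ≤ g' i) :
    θ * (g 0 + g 1 + g 2) ≤ g' 0 + g' 1 + g' 2 := by
  have h0 := h 0 (by norm_num)
  have h1 := h 1 (by norm_num)
  have h2 := h 2 (by norm_num)
  nlinarith

/-- PROVED (the numbers of record as a closed instance): with cand8-012's tripwire `ρ = 0.96` a next-window span of
at most `0.57` of a positive current span fails gap rigidity. [folklore] -/
theorem not_gapRigid_tripwire {l l' : ℕ → ℝ} (hpos : 0 < l 3 - l 0)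
    (hspan : l' 3 - l' 0 ≤ 0.57 * (l 3 - l 0)) : ¬ gapRigid 0.96 l l' :=
  not_gapRigid_of_span_lt (by nlinarith)

end Summit.RiemannHypothesis.RiemannHypothesis.Theorems.PfPersistence.F6
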